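import Summits.AtomisticToContinuum.Crystallization.Theorems.FrustratedLawDichotomyTwoShellRigidityTetraCell
import Summits.AtomisticToContinuum.Crystallization.Theorems.FrustratedLawDichotomyTwoShellRigidityOctaCoeffs

/-!
# FrustratedLawDichotomy · the cell lemma `OctaCellAt` of R (coarse capped rigidity) — PROVED, both patterns, `c = 18`

Beneath the landed cut `KR2_shape ⟸ G ∧ P ∧ M` (`FrustratedLawDichotomyTwoShellRigidityCut`, p820342) and lens-5's split of
`R = CoarseCappedRigidity K θ` into `Extraction ∧ TetraCell ∧ OctaCell ∧ FrameAssembly` (glue `coarseCappedRigidityAt_of_cells`;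
`Extraction θ` p820807, `TetraCellAt 11` p821511), this file PROVES the OCTAHEDRAL cell lemma `OctaCellAt c Pat` for BOTH kissing
patterns with the explicit constant `c = 18` (`octaCellAt_fcc`, `octaCellAt_hcp`, `octaCellAt_mono`, `cellLemmas_tetra_octa`):
centre `0` + link square `u, w, v, w'` + its cap, twelve edges in the `θ`-windows, the two square diagonals `≥ d` and the centre–cap
distance `≥ d/(1+θ)` ⟹ ONE linear isometry fits the square within `18·θ·d` and the cap within `18·θ·d` of `d·A(u+v)`.

Method (elementary, certificate-free; the lemma «the cap buys»): AXES FIRST.  With `B, B', C, C'` the square and `Q` the cap, the axes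
`m = B − B'`, `n = C − C'` are near-orthogonal and `Q`, `B + B'`, `C + C'` are near-normal to both (differences of near-equal squared
edges); in the Gram–Schmidt frame of `(m, n, Q)` (`gramSchmidt_triple`; `ζ ≥ 0` orients the normal towards the cap) the cap relations
`⟨Q, B+B'⟩ ≈ ⟨Q, C+C'⟩ ≈ |Q|²` and `⟨B+B', C+C'⟩ ≈ 2` force all three diagonals to have length `≈ √2` — the near-regular octahedron;
the folded square (jitterbug, `not_krShape12`) is excluded exactly by the cap.  The arithmetic is `FrustratedLawDichotomyTwoShellRigidityOctaCoeffs.octa_coeff_bounds`.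
No `sorry`, no defs.
-/

noncomputable section

namespace Summit.AtomisticToContinuum.Crystallization.Theorems.FrustratedLawDichotomyTwoShellRigidityOctaCell

open Literature.Geometry.DiscreteGeometry
open Summit.AtomisticToContinuum.Crystallization.Theorems.FrustratedLawDichotomyTwoShellRigidityCut (E3)
open Summit.AtomisticToContinuum.Crystallization.Theorems.FrustratedLawDichotomyTwoShellRigidityCells
open Summit.AtomisticToContinuum.Crystallization.Theorems.FrustratedLawDichotomyTwoShellRigidityFrames
open Summit.AtomisticToContinuum.Crystallization.Theorems.FrustratedLawDichotomyTwoShellRigidityTetraCell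
  (inner_eq_half_of_unit inner_eq_of_dist)
open Summit.AtomisticToContinuum.Crystallization.Theorems.FrustratedLawDichotomyTwoShellRigidityOctaCoeffs (octa_coeff_bounds)
open scoped RealInnerProductSpace

/-! ## Frame expansion and pattern facts -/

/-- Expansion of any vector in an orthonormal frame of `ℝ³`: `x = ⟪x,f₀⟫f₀ + ⟪x,f₁⟫f₁ + ⟪x,f₂⟫f₂`. [folklore] -/
theorem frame_expand {f₀ f₁ f₂ : E3} (h0 : ‖f₀‖ = 1) (h1 : ‖f₁‖ = 1) (h2 : ‖f₂‖ = 1) (h01 : ⟪f₀, f₁⟫ = 0)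
    (h02 : ⟪f₀, f₂⟫ = 0) (h12 : ⟪f₁, f₂⟫ = 0) (x : E3) : x = ⟪x, f₀⟫ • f₀ + ⟪x, f₁⟫ • f₁ + ⟪x, f₂⟫ • f₂ := by
  classical
  have h10 : ⟪f₁, f₀⟫ = 0 := by rw [real_inner_comm, h01]
  have h20 : ⟪f₂, f₀⟫ = 0 := by rw [real_inner_comm, h02]
  have h21 : ⟪f₂, f₁⟫ = 0 := by rw [real_inner_comm, h12]
  have hon : Orthonormal ℝ ![f₀, f₁, f₂] := by
    rw [orthonormal_iff_ite]
    intro i j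
    fin_cases i <;> fin_cases j <;> simp [h0, h1, h2, h01, h02, h12, h10, h20, h21]
  have hcard : Fintype.card (Fin 3) = Module.finrank ℝ E3 := by rw [Fintype.card_fin, finrank_euclideanSpace_fin]
  let b : OrthonormalBasis (Fin 3) ℝ E3 := OrthonormalBasis.mk hon
    (by rw [hon.linearIndependent.span_eq_top_of_card_eq_finrank hcard])
  have hb : ∀ k, b k = ![f₀, f₁, f₂] k := fun k => by rw [OrthonormalBasis.coe_mk]
  have hx := b.sum_repr' x
  rw [Fin.sum_univ_three, hb, hb, hb] at hx
  simp only [Matrix.cons_val_zero, Matrix.cons_val_one, Matrix.cons_val] at hx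
  rw [← real_inner_comm f₀ x, ← real_inner_comm f₁ x, ← real_inner_comm f₂ x] at hx
  exact hx.symm

/-- Unit vectors at distance `√2` are orthogonal. [folklore] -/
theorem inner_eq_zero_of_unit {u v : E3} (hu : ‖u‖ = 1) (hv : ‖v‖ = 1) (h : dist u v = Real.sqrt 2) : ⟪u, v⟫ = 0 := by
  have h1 : ‖u - v‖ ^ 2 = ‖u‖ ^ 2 - 2 * ⟪u, v⟫ + ‖v‖ ^ 2 := norm_sub_sq_real u v
  rw [← dist_eq_norm, h, Real.sq_sqrt (by norm_num), hu, hv] at h1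
  linarith

/-- In a link square of a pattern of unit vectors the two diagonals share their midpoint: `w + w' = u + v`. [folklore] -/
theorem square_diag_sum {u v w w' : E3} (hu : ‖u‖ = 1) (hv : ‖v‖ = 1) (hw : ‖w‖ = 1) (hw' : ‖w'‖ = 1)
    (huv : dist u v = Real.sqrt 2) (hwu : dist w u = 1) (hwv : dist w v = 1) (hw'u : dist w' u = 1) (hw'v : dist w' v = 1)
    (hww' : dist w w' = Real.sqrt 2) : w + w' = u + v := by
  have i1 := inner_eq_zero_of_unit hu hv huv
  have i2 := inner_eq_zero_of_unit hw hw' hww'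
  have i3 := inner_eq_half_of_unit hw hu hwu
  have i4 := inner_eq_half_of_unit hw hv hwv
  have i5 := inner_eq_half_of_unit hw' hu hw'u
  have i6 := inner_eq_half_of_unit hw' hv hw'v
  have h : ‖(w + w') - (u + v)‖ ^ 2 = 0 := by
    rw [norm_sub_sq_real, norm_add_sq_real, norm_add_sq_real, inner_add_left, inner_add_right, inner_add_right, hu, hv, hw,
      hw', i1, i2, i3, i4, i5, i6]
    norm_num
  rw [sq_eq_zero_iff, norm_eq_zero, sub_eq_zero] at h
  exact h

/-! ## The near-regular octahedron with vertex `0` -/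

set_option maxHeartbeats 400000 in
/-- **Near-regular octahedron, normalised.**  Reference: unit `u, v, w, w'` with `dist u v = dist w w' = √2` and the four sides `1`.
Data: square `B, B', C, C'` with norms in `[1, 1+t]`, sides and cap bonds in `[1/(1+t), (1+t)²]`, diagonals `≥ 1`, `‖Q‖ ≥ 1/(1+t)`,
`0 < t ≤ 1/100` ⟹ a linear isometry `A` with all five deviations `≤ 18·t`. [folklore] -/
theorem octa_fit_unit {u v w w' B B' C C' Q : E3} (hu : ‖u‖ = 1) (hv : ‖v‖ = 1) (hw : ‖w‖ = 1) (hw' : ‖w'‖ = 1)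
    (huv : dist u v = Real.sqrt 2) (hwu : dist w u = 1) (hwv : dist w v = 1) (hw'u : dist w' u = 1) (hw'v : dist w' v = 1)
    (hww' : dist w w' = Real.sqrt 2) {t : ℝ} (ht0 : 0 < t) (ht1 : t ≤ 1 / 100)
    (hB1 : 1 ≤ ‖B‖) (hB2 : ‖B‖ ≤ 1 + t) (hB'1 : 1 ≤ ‖B'‖) (hB'2 : ‖B'‖ ≤ 1 + t) (hC1 : 1 ≤ ‖C‖) (hC2 : ‖C‖ ≤ 1 + t)
    (hC'1 : 1 ≤ ‖C'‖) (hC'2 : ‖C'‖ ≤ 1 + t)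
    (hBC1 : 1 / (1 + t) ≤ dist B C) (hBC2 : dist B C ≤ (1 + t) ^ 2) (hBC'1 : 1 / (1 + t) ≤ dist B C')
    (hBC'2 : dist B C' ≤ (1 + t) ^ 2) (hB'C1 : 1 / (1 + t) ≤ dist B' C) (hB'C2 : dist B' C ≤ (1 + t) ^ 2)
    (hB'C'1 : 1 / (1 + t) ≤ dist B' C') (hB'C'2 : dist B' C' ≤ (1 + t) ^ 2)
    (hQB1 : 1 / (1 + t) ≤ dist Q B) (hQB2 : dist Q B ≤ (1 + t) ^ 2) (hQB'1 : 1 / (1 + t) ≤ dist Q B')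
    (hQB'2 : dist Q B' ≤ (1 + t) ^ 2) (hQC1 : 1 / (1 + t) ≤ dist Q C) (hQC2 : dist Q C ≤ (1 + t) ^ 2)
    (hQC'1 : 1 / (1 + t) ≤ dist Q C') (hQC'2 : dist Q C' ≤ (1 + t) ^ 2)
    (hBB' : 1 ≤ dist B B') (hCC' : 1 ≤ dist C C') (hQ0 : 1 / (1 + t) ≤ ‖Q‖) :
    ∃ A : E3 →ₗᵢ[ℝ] E3, ‖B - A u‖ ≤ 18 * t ∧ ‖B' - A v‖ ≤ 18 * t ∧ ‖C - A w‖ ≤ 18 * t ∧ ‖C' - A w'‖ ≤ 18 * t ∧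
      ‖Q - A (u + v)‖ ≤ 18 * t := by
  have hV : Module.finrank ℝ E3 = 3 := finrank_euclideanSpace_fin
  obtain ⟨s, hs_def⟩ : ∃ s : ℝ, Real.sqrt 2 = s := ⟨_, rfl⟩
  have hs0 : 0 ≤ s := by rw [← hs_def]; exact Real.sqrt_nonneg 2
  have hs : s ^ 2 = 2 := by rw [← hs_def]; exact Real.sq_sqrt (by norm_num)
  have hs_ne : s ≠ 0 := fun h => by rw [h] at hs; norm_num at hs
  have i1 := inner_eq_zero_of_unit hu hv huv
  have i2 := inner_eq_zero_of_unit hw hw' hww'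
  have i3 := inner_eq_half_of_unit hw hu hwu
  have i4 := inner_eq_half_of_unit hw hv hwv
  have i5 := inner_eq_half_of_unit hw' hu hw'u
  have i6 := inner_eq_half_of_unit hw' hv hw'v
  have hsum := square_diag_sum hu hv hw hw' huv hwu hwv hw'u hw'v hww'
  rw [hs_def] at huv hww'
  -- ### reference frame
  obtain ⟨e₀, e₁, e₂, β₀, γ₀, δ₀, ε₀, ζ₀, he0, he1, he2, he01, he02, he12, r1', r2', r3', hγ₀, hζ₀⟩ :=
    gramSchmidt_triple hV (u - v) (w - w') (u + v)
  have hE := inner_frame he0 he1 he2 he01 he02 he12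
  have hEn := norm_sq_frame he0 he1 he2 he01 he02 he12
  rw [← dist_eq_norm, huv] at r1'
  have i3' : ⟪u, w⟫ = 1 / 2 := by rw [real_inner_comm]; exact i3
  have i4' : ⟪v, w⟫ = 1 / 2 := by rw [real_inner_comm]; exact i4
  have i5' : ⟪u, w'⟫ = 1 / 2 := by rw [real_inner_comm]; exact i5
  have i6' : ⟪v, w'⟫ = 1 / 2 := by rw [real_inner_comm]; exact i6
  have r1 : u - v = s • e₀ + (0 : ℝ) • e₁ + (0 : ℝ) • e₂ := by rw [r1']; module
  have r2 : w - w' = β₀ • e₀ + γ₀ • e₁ + (0 : ℝ) • e₂ := by rw [r2']; module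
  -- reference Gram data
  have q1 : β₀ = 0 := by
    have h := hE s 0 0 β₀ γ₀ 0
    rw [← r1, ← r2, inner_sub_left, inner_sub_right, inner_sub_right, i3', i4', i5', i6'] at h
    have : s * β₀ = 0 := by linarith only [h]
    rcases mul_eq_zero.1 this with h' | h'
    · exact absurd h' hs_ne
    · exact h'
  have q2 : γ₀ = s := by
    have h := hEn β₀ γ₀ 0
    rw [← r2, ← dist_eq_norm, hww', q1] at h
    have h2 : γ₀ ^ 2 = s ^ 2 := by linarith only [h, hs]
    exact (sq_eq_sq₀ hγ₀ hs0).1 h2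
  have q3 : δ₀ = 0 := by
    have h := hE s 0 0 δ₀ ε₀ ζ₀
    rw [← r1, ← r3', inner_sub_left, inner_add_right, inner_add_right, real_inner_self_eq_norm_sq,
      real_inner_self_eq_norm_sq, real_inner_comm u v, hu, hv] at h
    have : s * δ₀ = 0 := by linarith only [h, i1]
    rcases mul_eq_zero.1 this with h' | h'
    · exact absurd h' hs_ne
    · exact h'
  have q4 : ε₀ = 0 := by
    have h := hE β₀ γ₀ 0 δ₀ ε₀ ζ₀
    rw [← r2, ← r3', inner_sub_left, inner_add_right, inner_add_right, i3, i4, i5, i6, q1, q2, q3] at h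
    have : s * ε₀ = 0 := by linarith only [h]
    rcases mul_eq_zero.1 this with h' | h'
    · exact absurd h' hs_ne
    · exact h'
  have q5 : ζ₀ = s := by
    have h := hEn δ₀ ε₀ ζ₀
    rw [← r3', norm_add_sq_real, hu, hv, i1, q3, q4] at h
    have h2 : ζ₀ ^ 2 = s ^ 2 := by linarith only [h, hs]
    exact (sq_eq_sq₀ hζ₀ hs0).1 h2
  rw [q3, q4, q5] at r3'
  rw [q1, q2] at r2
  have u3 : u = (s / 2) • e₀ + (0 : ℝ) • e₁ + (s / 2) • e₂ := by
    have h : u = (1 / 2 : ℝ) • ((u - v) + (u + v)) := by module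
    rw [h, r1, r3']; module
  have v3 : v = (-(s / 2)) • e₀ + (0 : ℝ) • e₁ + (s / 2) • e₂ := by
    have h : v = (1 / 2 : ℝ) • ((u + v) - (u - v)) := by module
    rw [h, r1, r3']; module
  have w3 : w = (0 : ℝ) • e₀ + (s / 2) • e₁ + (s / 2) • e₂ := by
    have h : w = (1 / 2 : ℝ) • ((w - w') + (w + w')) := by module
    rw [h, hsum, r2, r3']; module
  have w3' : w' = (0 : ℝ) • e₀ + (-(s / 2)) • e₁ + (s / 2) • e₂ := by
    have h : w' = (1 / 2 : ℝ) • ((w + w') - (w - w')) := by module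
    rw [h, hsum, r2, r3']; module
  have upv3 : u + v = (0 : ℝ) • e₀ + (0 : ℝ) • e₁ + s • e₂ := r3'
  -- ### data frame: axes `m, n`, sums `SB, SC`
  obtain ⟨m, hm⟩ : ∃ m : E3, m = B - B' := ⟨_, rfl⟩
  obtain ⟨n, hn⟩ : ∃ n : E3, n = C - C' := ⟨_, rfl⟩
  obtain ⟨SB, hSB⟩ : ∃ SB : E3, SB = B + B' := ⟨_, rfl⟩
  obtain ⟨SC, hSC⟩ : ∃ SC : E3, SC = C + C' := ⟨_, rfl⟩
  obtain ⟨f₀, f₁, f₂, β, γ, δ, ε, ζ, hf0, hf1, hf2, hf01, hf02, hf12, m3', n3', Q3, hγ, hζ⟩ := gramSchmidt_triple hV m n Q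
  have hF := inner_frame hf0 hf1 hf2 hf01 hf02 hf12
  have hFn := norm_sq_frame hf0 hf1 hf2 hf01 hf02 hf12
  obtain ⟨α, hα⟩ : ∃ α : ℝ, ‖m‖ = α := ⟨_, rfl⟩
  obtain ⟨nn, hnn⟩ : ∃ nn : ℝ, ‖n‖ = nn := ⟨_, rfl⟩
  have m3 : m = α • f₀ + (0 : ℝ) • f₁ + (0 : ℝ) • f₂ := by rw [m3', hα]; module
  have n3 : n = β • f₀ + γ • f₁ + (0 : ℝ) • f₂ := by rw [n3']; module
  have sb3 := frame_expand hf0 hf1 hf2 hf01 hf02 hf12 SB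
  have sc3 := frame_expand hf0 hf1 hf2 hf01 hf02 hf12 SC
  obtain ⟨σ₁, hσ₁⟩ : ∃ x : ℝ, ⟪SB, f₀⟫ = x := ⟨_, rfl⟩
  obtain ⟨σ₂, hσ₂⟩ : ∃ x : ℝ, ⟪SB, f₁⟫ = x := ⟨_, rfl⟩
  obtain ⟨μ, hμ⟩ : ∃ x : ℝ, ⟪SB, f₂⟫ = x := ⟨_, rfl⟩
  obtain ⟨τ₁, hτ₁⟩ : ∃ x : ℝ, ⟪SC, f₀⟫ = x := ⟨_, rfl⟩
  obtain ⟨τ₂, hτ₂⟩ : ∃ x : ℝ, ⟪SC, f₁⟫ = x := ⟨_, rfl⟩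
  obtain ⟨ν, hν⟩ : ∃ x : ℝ, ⟪SC, f₂⟫ = x := ⟨_, rfl⟩
  rw [hσ₁, hσ₂, hμ] at sb3
  rw [hτ₁, hτ₂, hν] at sc3
  -- metric values of the pairwise inner products
  have pBC := inner_eq_of_dist B C
  have pBC' := inner_eq_of_dist B C'
  have pB'C := inner_eq_of_dist B' C
  have pB'C' := inner_eq_of_dist B' C'
  have pQB := inner_eq_of_dist Q B
  have pQB' := inner_eq_of_dist Q B'
  have pQC := inner_eq_of_dist Q C
  have pQC' := inner_eq_of_dist Q C'
  have nBB : ⟪B, B⟫ = ‖B‖ ^ 2 := real_inner_self_eq_norm_sq B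
  have nB'B' : ⟪B', B'⟫ = ‖B'‖ ^ 2 := real_inner_self_eq_norm_sq B'
  have nCC : ⟪C, C⟫ = ‖C‖ ^ 2 := real_inner_self_eq_norm_sq C
  have nC'C' : ⟪C', C'⟫ = ‖C'‖ ^ 2 := real_inner_self_eq_norm_sq C'
  have hα1 : 1 ≤ α := by rw [← hα, hm, ← dist_eq_norm]; exact hBB'
  have hnn1 : 1 ≤ nn := by rw [← hnn, hn, ← dist_eq_norm]; exact hCC'
  have hnQ2 : ‖Q‖ ≤ dist Q B + ‖B‖ := by
    have := norm_le_norm_add_norm_sub' Q B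
    rw [dist_eq_norm]; linarith only [this]
  -- the fourteen Gram relations (frame side = metric side)
  have g1 := hF α 0 0 β γ 0
  rw [← m3, ← n3, hm, hn] at g1
  simp only [inner_sub_left, inner_sub_right] at g1
  have g2 := hFn β γ 0
  rw [← n3, hnn] at g2
  have g3 := hF α 0 0 δ ε ζ
  rw [← m3, ← Q3, hm, inner_sub_left, real_inner_comm Q B, real_inner_comm Q B'] at g3
  have g4 := hF β γ 0 δ ε ζ
  rw [← n3, ← Q3, hn, inner_sub_left, real_inner_comm Q C, real_inner_comm Q C'] at g4
  have g5 := hFn δ ε ζ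
  rw [← Q3] at g5
  have g6 := hF α 0 0 σ₁ σ₂ μ
  rw [← m3, ← sb3, hm, hSB] at g6
  simp only [inner_sub_left, inner_add_right, real_inner_comm B B'] at g6
  have g7 := hF β γ 0 σ₁ σ₂ μ
  rw [← n3, ← sb3, hn, hSB] at g7
  simp only [inner_sub_left, inner_add_right, real_inner_comm B C, real_inner_comm B C', real_inner_comm B' C,
    real_inner_comm B' C'] at g7
  have g8 := hF δ ε ζ σ₁ σ₂ μ
  rw [← Q3, ← sb3, hSB, inner_add_right] at g8
  have g9 := hF α 0 0 τ₁ τ₂ ν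
  rw [← m3, ← sc3, hm, hSC] at g9
  simp only [inner_sub_left, inner_add_right] at g9
  have g10 := hF β γ 0 τ₁ τ₂ ν
  rw [← n3, ← sc3, hn, hSC] at g10
  simp only [inner_sub_left, inner_add_right, real_inner_comm C C'] at g10
  have g11 := hF δ ε ζ τ₁ τ₂ ν
  rw [← Q3, ← sc3, hSC, inner_add_right] at g11
  have g12 := hF σ₁ σ₂ μ τ₁ τ₂ ν
  rw [← sb3, ← sc3, hSB, hSC] at g12
  simp only [inner_add_left, inner_add_right] at g12
  have g13 := hFn σ₁ σ₂ μ
  rw [← sb3, hSB, norm_add_sq_real] at g13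
  have g14 := hFn τ₁ τ₂ ν
  rw [← sc3, hSC, norm_add_sq_real] at g14
  have hα2 : α ^ 2 = ‖B‖ ^ 2 - 2 * ⟪B, B'⟫ + ‖B'‖ ^ 2 := by rw [← hα, hm]; exact norm_sub_sq_real B B'
  have hnn2 : nn ^ 2 = ‖C‖ ^ 2 - 2 * ⟪C, C'⟫ + ‖C'‖ ^ 2 := by rw [← hnn, hn]; exact norm_sub_sq_real C C'
  have hQQ : ‖Q‖ ^ 2 = ⟪Q, Q⟫ := (real_inner_self_eq_norm_sq Q).symm
  obtain ⟨bQ, bB, bB', bC, bC'⟩ := octa_coeff_bounds (α := α) (nn := nn) (β := β) (γ := γ) (δ := δ) (ε := ε) (ζ := ζ)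
    (σ₁ := σ₁) (σ₂ := σ₂) (μ := μ) (τ₁ := τ₁) (τ₂ := τ₂) (ν := ν) (s := s) ht0 ht1 hB1 hB2 hB'1 hB'2 hC1 hC2 hC'1 hC'2 hBC1 hBC2 hBC'1 hBC'2
    hB'C1 hB'C2 hB'C'1 hB'C'2 hQB1 hQB2 hQB'1 hQB'2 hQC1 hQC2 hQC'1 hQC'2 hα1 hnn1 hγ hζ hQ0 hnQ2
    (by linarith only [g1, pBC, pBC', pB'C, pB'C']) (by linarith only [g2]) (by linarith only [g3, pQB, pQB'])
    (by linarith only [g4, pQC, pQC']) (by linarith only [g5]) (by linarith only [g6, nBB, nB'B'])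
    (by linarith only [g7, pBC, pBC', pB'C, pB'C']) (by linarith only [g8, pQB, pQB'])
    (by linarith only [g9, pBC, pBC', pB'C, pB'C']) (by linarith only [g10, nCC, nC'C']) (by linarith only [g11, pQC, pQC'])
    (by linarith only [g12, pBC, pBC', pB'C, pB'C']) (by linarith only [g13, hα2]) (by linarith only [g14, hnn2])
    hs0 hs
  -- ### the isometry and the five error vectors
  obtain ⟨A, hA0, hA1, hA2⟩ := exists_linearIsometry_of_frames hV he0 he1 he2 he01 he02 he12 hf0 hf1 hf2 hf01 hf02 hf12
  have hBh : B = (1 / 2 : ℝ) • (m + SB) := by rw [hm, hSB]; module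
  have hB'h : B' = (1 / 2 : ℝ) • (SB - m) := by rw [hm, hSB]; module
  have hCh : C = (1 / 2 : ℝ) • (n + SC) := by rw [hn, hSC]; module
  have hC'h : C' = (1 / 2 : ℝ) • (SC - n) := by rw [hn, hSC]; module
  have vB : B - A u = ((α + σ₁ - s) / 2) • f₀ + (σ₂ / 2) • f₁ + ((μ - s) / 2) • f₂ := by
    rw [hBh, u3, map_add, map_add, map_smul, map_smul, map_smul, hA0, hA1, hA2, m3]
    nth_rewrite 1 [sb3]
    module
  have vB' : B' - A v = ((σ₁ - α + s) / 2) • f₀ + (σ₂ / 2) • f₁ + ((μ - s) / 2) • f₂ := by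
    rw [hB'h, v3, map_add, map_add, map_smul, map_smul, map_smul, hA0, hA1, hA2, m3]
    nth_rewrite 1 [sb3]
    module
  have vC : C - A w = ((β + τ₁) / 2) • f₀ + ((γ + τ₂ - s) / 2) • f₁ + ((ν - s) / 2) • f₂ := by
    rw [hCh, w3, map_add, map_add, map_smul, map_smul, map_smul, hA0, hA1, hA2, n3]
    nth_rewrite 1 [sc3]
    module
  have vC' : C' - A w' = ((τ₁ - β) / 2) • f₀ + ((τ₂ - γ + s) / 2) • f₁ + ((ν - s) / 2) • f₂ := by
    rw [hC'h, w3', map_add, map_add, map_smul, map_smul, map_smul, hA0, hA1, hA2, n3]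
    nth_rewrite 1 [sc3]
    module
  have vQ : Q - A (u + v) = δ • f₀ + ε • f₁ + (ζ - s) • f₂ := by
    rw [upv3, map_add, map_add, map_smul, map_smul, map_smul, hA0, hA1, hA2]
    nth_rewrite 1 [Q3]
    module
  have h18 : (0 : ℝ) ≤ 18 * t := by positivity
  refine ⟨A, ?_, ?_, ?_, ?_, ?_⟩
  · rw [vB]; exact norm_frame_le hf0 hf1 hf2 hf01 hf02 hf12 h18 bB
  · rw [vB']; exact norm_frame_le hf0 hf1 hf2 hf01 hf02 hf12 h18 bB'
  · rw [vC]; exact norm_frame_le hf0 hf1 hf2 hf01 hf02 hf12 h18 bC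
  · rw [vC']; exact norm_frame_le hf0 hf1 hf2 hf01 hf02 hf12 h18 bC'
  · rw [vQ]; exact norm_frame_le hf0 hf1 hf2 hf01 hf02 hf12 h18 bQ

/-- **Near-regular octahedron at scale `d`** (the windows of `OctaCellAt`): all five deviations `≤ 18·θ·d`. [folklore] -/
theorem octa_fit {u v w w' : E3} (hu : ‖u‖ = 1) (hv : ‖v‖ = 1) (hw : ‖w‖ = 1) (hw' : ‖w'‖ = 1)
    (huv : dist u v = Real.sqrt 2) (hwu : dist w u = 1) (hwv : dist w v = 1) (hw'u : dist w' u = 1) (hw'v : dist w' v = 1)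
    (hww' : dist w w' = Real.sqrt 2) {θ d : ℝ} (hθ0 : 0 < θ) (hθ1 : θ ≤ 1 / 100) (hd : 0 < d) {B B' C C' Q : E3}
    (hB1 : d ≤ ‖B‖) (hB2 : ‖B‖ ≤ (1 + θ) * d) (hB'1 : d ≤ ‖B'‖) (hB'2 : ‖B'‖ ≤ (1 + θ) * d) (hC1 : d ≤ ‖C‖)
    (hC2 : ‖C‖ ≤ (1 + θ) * d) (hC'1 : d ≤ ‖C'‖) (hC'2 : ‖C'‖ ≤ (1 + θ) * d)
    (hBC1 : d / (1 + θ) ≤ dist B C) (hBC2 : dist B C ≤ (1 + θ) ^ 2 * d) (hBC'1 : d / (1 + θ) ≤ dist B C')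
    (hBC'2 : dist B C' ≤ (1 + θ) ^ 2 * d) (hB'C1 : d / (1 + θ) ≤ dist B' C) (hB'C2 : dist B' C ≤ (1 + θ) ^ 2 * d)
    (hB'C'1 : d / (1 + θ) ≤ dist B' C') (hB'C'2 : dist B' C' ≤ (1 + θ) ^ 2 * d)
    (hQB1 : d / (1 + θ) ≤ dist Q B) (hQB2 : dist Q B ≤ (1 + θ) ^ 2 * d) (hQB'1 : d / (1 + θ) ≤ dist Q B')
    (hQB'2 : dist Q B' ≤ (1 + θ) ^ 2 * d) (hQC1 : d / (1 + θ) ≤ dist Q C) (hQC2 : dist Q C ≤ (1 + θ) ^ 2 * d)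
    (hQC'1 : d / (1 + θ) ≤ dist Q C') (hQC'2 : dist Q C' ≤ (1 + θ) ^ 2 * d)
    (hBB' : d ≤ dist B B') (hCC' : d ≤ dist C C') (hQ0 : d / (1 + θ) ≤ ‖Q‖) :
    ∃ A : E3 →ₗᵢ[ℝ] E3, ‖B - d • A u‖ ≤ 18 * θ * d ∧ ‖B' - d • A v‖ ≤ 18 * θ * d ∧ ‖C - d • A w‖ ≤ 18 * θ * d ∧
      ‖C' - d • A w'‖ ≤ 18 * θ * d ∧ ‖Q - d • A (u + v)‖ ≤ 18 * θ * d := by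
  have hd' : d ≠ 0 := hd.ne'
  have h1θ : 0 < 1 + θ := by linarith
  have hnd : ‖d⁻¹‖ = d⁻¹ := by rw [Real.norm_eq_abs, abs_of_pos (inv_pos.2 hd)]
  have hnorm : ∀ {x : E3}, d ≤ ‖x‖ → ‖x‖ ≤ (1 + θ) * d → 1 ≤ ‖d⁻¹ • x‖ ∧ ‖d⁻¹ • x‖ ≤ 1 + θ := by
    intro x h1 h2
    rw [norm_smul, hnd, inv_mul_eq_div]
    exact ⟨(one_le_div hd).2 h1, (div_le_iff₀ hd).2 h2⟩
  have hdist : ∀ {x x' : E3}, d / (1 + θ) ≤ dist x x' → dist x x' ≤ (1 + θ) ^ 2 * d →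
      1 / (1 + θ) ≤ dist (d⁻¹ • x) (d⁻¹ • x') ∧ dist (d⁻¹ • x) (d⁻¹ • x') ≤ (1 + θ) ^ 2 := by
    intro x x' h1 h2
    rw [dist_smul₀, hnd, inv_mul_eq_div]
    refine ⟨(le_div_iff₀ hd).2 ?_, (div_le_iff₀ hd).2 h2⟩
    rw [div_mul_eq_mul_div, one_mul]
    exact h1
  have hdiag : ∀ {x x' : E3}, d ≤ dist x x' → 1 ≤ dist (d⁻¹ • x) (d⁻¹ • x') := by
    intro x x' h1
    rw [dist_smul₀, hnd, inv_mul_eq_div]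
    exact (one_le_div hd).2 h1
  have hQ0' : 1 / (1 + θ) ≤ ‖d⁻¹ • Q‖ := by
    rw [norm_smul, hnd, inv_mul_eq_div, le_div_iff₀ hd, div_mul_eq_mul_div, one_mul]
    exact hQ0
  obtain ⟨hB1', hB2'⟩ := hnorm hB1 hB2
  obtain ⟨hB'1', hB'2'⟩ := hnorm hB'1 hB'2
  obtain ⟨hC1', hC2'⟩ := hnorm hC1 hC2
  obtain ⟨hC'1', hC'2'⟩ := hnorm hC'1 hC'2
  obtain ⟨hBC1', hBC2'⟩ := hdist hBC1 hBC2
  obtain ⟨hBC'1', hBC'2'⟩ := hdist hBC'1 hBC'2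
  obtain ⟨hB'C1', hB'C2'⟩ := hdist hB'C1 hB'C2
  obtain ⟨hB'C'1', hB'C'2'⟩ := hdist hB'C'1 hB'C'2
  obtain ⟨hQB1', hQB2'⟩ := hdist hQB1 hQB2
  obtain ⟨hQB'1', hQB'2'⟩ := hdist hQB'1 hQB'2
  obtain ⟨hQC1', hQC2'⟩ := hdist hQC1 hQC2
  obtain ⟨hQC'1', hQC'2'⟩ := hdist hQC'1 hQC'2
  obtain ⟨A, h1, h2, h3, h4, h5⟩ := octa_fit_unit hu hv hw hw' huv hwu hwv hw'u hw'v hww' hθ0 hθ1 hB1' hB2' hB'1' hB'2' hC1'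
    hC2' hC'1' hC'2' hBC1' hBC2' hBC'1' hBC'2' hB'C1' hB'C2' hB'C'1' hB'C'2' hQB1' hQB2' hQB'1' hQB'2' hQC1' hQC2' hQC'1' hQC'2'
    (hdiag hBB') (hdiag hCC') hQ0'
  have hscale : ∀ {x z : E3}, ‖d⁻¹ • x - A z‖ ≤ 18 * θ → ‖x - d • A z‖ ≤ 18 * θ * d := by
    intro x z h
    have hx : x - d • A z = d • (d⁻¹ • x - A z) := by rw [smul_sub, smul_smul, mul_inv_cancel₀ hd', one_smul]
    rw [hx, norm_smul, Real.norm_eq_abs, abs_of_pos hd]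
    have := mul_le_mul_of_nonneg_left h hd.le
    linarith only [this]
  exact ⟨A, hscale h1, hscale h2, hscale h3, hscale h4, hscale h5⟩

end Summit.AtomisticToContinuum.Crystallization.Theorems.FrustratedLawDichotomyTwoShellRigidityOctaCell

end
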